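import Literature.MathematicalPhysics.QuantumFieldTheory.Balaban1983to89.T4StairWordPrefix
import Literature.MathematicalPhysics.QuantumFieldTheory.Balaban1983to89.BlockAveragingEMLProp2
import Literature.MathematicalPhysics.QuantumFieldTheory.Balaban1983to89.B10StarCount
import Literature.MathematicalPhysics.QuantumFieldTheory.Balaban1983to89.B3Taylor310LocalRemainder
import HarnessLib

/-!
# Crux stmt-QuantumFields-19936 `HistoryTailL` — THE HIERARCHICAL ALIGNMENT («ALIGN»), WORD AND BLOCK BOOKKEEPING

Cell `ym3-torus` (YM ladder rung R3 = continuum SU(2) Yang–Mills on the three-torus — a RUNG, NOT the Clay problem; not d = 4, not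
infinite volume, not a mass gap), width seat `ym-ust-19936-w3` gen 12, `--supports stmt-QuantumFields-19936 --as helper`.  LEAD
★w1-19936 g7 word 01:07:50Z «ALIGN GO» (card v1.28∕v1.29 (c), ★w5 g10 LOCATE (R3)-COV §5 route (i)): the deep-regime a-priori sup-chart is
Bałaban's `k`-level axial gauge [Balaban1985Averaging] §C (64)–(68) with the AVERAGES as coarse variables.  THIS FILE holds the
`Params`-generic bookkeeping consumed by the one-level step `PoincareLipschitzHierAlignStep` (companion file):

* §1 (letter counts versus net displacements by ✓`LatticeWordCountBox`) a word within the letter budget of a word with counts `≤ N` has net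
  displacements in `[−N, N]` (`abs_netDisp_le_of_count_le`); the centred staircase uses each letter `≤ (L−1)∕2` times;
* §1b ★ `tdist_blockOf_walkEnd_le` — THE COUNT BOX OF A SHORT WORD READ FROM A BLOCK CENTRE: if every net displacement of `u` is in
  `[−(2L−1), 2L−1]` then `walkEnd (emb y) u` lies in a block within coarse torus distance `2d` of `y` (Euclidean decomposition of the
  displacement as `L·t + e`, `|t_κ| ≤ 2`, `|e_κ| ≤ (L−1)∕2`, then `blockOf_eq_of_near_emb` at the translated centre `emb (y + t) = emb y + L·t`,
  ✓`Site.emb_add`); the three blocks of a coarse bond are within distance `2d`;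
* §2 the centred offsets `n(x)_κ = (x_κ mod L) − (L−1)∕2` of a fine site in its block (`|n_κ| ≤ (L−1)∕2`, `n(emb y) = 0`) and
  ★ `walkEnd_emb_blockOf_stairWord`: the staircase `Γ^σ(n(x))` from the centre `emb (blockOf x)` ends at `x` [Balaban1987RG1] (0.3).

THEOREMS ONLY, def-free, route-independent lattice kinematics; nothing of h⋆, F5∕F6, `BlockLipschitzL`, the stubs of any registered line, the
crux `HistoryTailL` or a summit statement is proved here.
-/

noncomputable section

open scoped BigOperators

namespace Summit.QuantumFields.YangMills.Theorems.PoincareLipschitzHierAlignWords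

open Literature.MathematicalPhysics.QuantumFieldTheory.Balaban1983to89
open T4Continuum T4ReflectionCone BlockAveraging AveragingRT
open LatticeWordStokes LatticeWordStokesLocal BlockAveragingPlaquetteBoundLocal
open Literature.MathematicalPhysics.QuantumFieldTheory.Balaban1983to89.B3Taylor310LocalRemainder (tdist_triangle tdist_comm tdist_self)

/-! ## §1 Words: counts, net displacements, and the count box of a short word read from a block centre -/

section Words

variable {d : ℕ}

/-- A word whose every letter count is `≤ N` has all net displacements in `[−N, N]`, and so does every word within its letter budget. [folklore] -/
theorem abs_netDisp_le_of_count_le {N : ℕ} {w u : List (Letter d)} (hw : ∀ l, w.count l ≤ N) (hu : ∀ l, u.count l ≤ w.count l)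
    (κ : Fin d) : -(N : ℤ) ≤ netDisp u κ ∧ netDisp u κ ≤ N := by
  have h1 := LatticeWordCountBox.netDisp_le_count_true κ u
  have h2 := LatticeWordCountBox.neg_count_false_le_netDisp κ u
  have b1 : ((u.count (κ, true) : ℕ) : ℤ) ≤ N := by exact_mod_cast (hu _).trans (hw _)
  have b2 : ((u.count (κ, false) : ℕ) : ℤ) ≤ N := by exact_mod_cast (hu _).trans (hw _)
  constructor <;> linarith

/-- The staircase word of a centred offset (`|n_κ| ≤ (L−1)/2`) uses every letter at most `(L−1)/2` times. [folklore] -/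
theorem count_stairWord_le_half {P : Params} (σ : Equiv.Perm (Fin P.d)) {n : Fin P.d → ℤ}
    (hn : ∀ κ, -(((P.L - 1) / 2 : ℕ) : ℤ) ≤ n κ ∧ n κ ≤ (((P.L - 1) / 2 : ℕ) : ℤ)) (l : Letter P.d) :
    (stairWord σ n).count l ≤ (P.L - 1) / 2 := by
  obtain ⟨κ, s⟩ := l
  refine (count_stairWord_le σ n κ s).trans ?_
  have := hn κ
  split_ifs <;> omega

end Words

/-! ## §1b The count box of a short word read from a block centre -/

section Geometry

variable {P : Params} {j : ℕ}

/-- The torus distance from `y + t` to `y` is at most `Σ_κ |t_κ|` (integer vector `t`). [folklore] -/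
theorem tdist_add_intCast_le (y T : Site P (j + 1)) (t : Fin P.d → ℤ)
    (hT : ∀ κ, T κ = ((t κ : ℤ) : ZMod (P.sitesPerDir (j + 1)))) :
    Site.tdist (y + T) y ≤ ∑ κ, (t κ).natAbs := by
  unfold Site.tdist
  refine Finset.sum_le_sum fun κ _ => ?_
  have e1 : (y + T) κ - y κ = ((t κ : ℤ) : ZMod (P.sitesPerDir (j + 1))) := by
    rw [Site.add_apply, hT]; ring
  have e2 : y κ - (y + T) κ = ((-t κ : ℤ) : ZMod (P.sitesPerDir (j + 1))) := by
    rw [Site.add_apply, hT]; push_cast; ring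
  rw [e1, e2]
  rcases le_or_gt 0 (t κ) with h | h
  · refine (min_le_left _ _).trans ?_
    have : ((t κ : ℤ) : ZMod (P.sitesPerDir (j + 1))) = (((t κ).natAbs : ℕ) : ZMod (P.sitesPerDir (j + 1))) := by
      rw [← Int.cast_natCast, Int.natAbs_of_nonneg h]
    rw [this, ZMod.val_natCast]
    exact Nat.mod_le _ _
  · refine (min_le_right _ _).trans ?_
    have : ((-t κ : ℤ) : ZMod (P.sitesPerDir (j + 1))) = (((t κ).natAbs : ℕ) : ZMod (P.sitesPerDir (j + 1))) := by
      rw [← Int.cast_natCast, Int.ofNat_natAbs_of_nonpos h.le]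
    rw [this, ZMod.val_natCast]
    exact Nat.mod_le _ _

/-- Cross-level scaling of an INTEGER coarse vector: `scale (t) κ = L·t_κ` in `ℤ∕N_j`. [folklore] -/
theorem scale_intCast_apply (T : Site P (j + 1)) (t : Fin P.d → ℤ)
    (hT : ∀ κ, T κ = ((t κ : ℤ) : ZMod (P.sitesPerDir (j + 1)))) (κ : Fin P.d) :
    Site.scale (P := P) (j := j) T κ = (((P.L : ℤ) * t κ : ℤ) : ZMod (P.sitesPerDir j)) := by
  rw [Site.scale_apply, Site.scaleCoord_apply, hT]
  rw [← Int.cast_natCast]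
  refine (ZMod.intCast_eq_intCast_iff _ _ _).mpr ?_
  -- `val (t : ℤ∕N_{j+1}) ≡ t (mod N_{j+1})`, hence `val·L ≡ L·t (mod N_{j+1}·L)` and `N_j ∣ N_{j+1}·L`
  have h1 : Int.ModEq (P.sitesPerDir (j + 1) : ℤ) ((((t κ : ℤ) : ZMod (P.sitesPerDir (j + 1))).val : ℕ) : ℤ) (t κ) := by
    refine (ZMod.intCast_eq_intCast_iff _ _ _).mp ?_
    rw [Int.cast_natCast, ZMod.natCast_zmod_val]
  have h2 : Int.ModEq ((P.sitesPerDir (j + 1) : ℤ) * (P.L : ℤ))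
      (((((t κ : ℤ) : ZMod (P.sitesPerDir (j + 1))).val : ℕ) : ℤ) * P.L) (t κ * P.L) := h1.mul_right'
  have hdvd : (P.sitesPerDir j : ℤ) ∣ (P.sitesPerDir (j + 1) : ℤ) * P.L := by
    exact_mod_cast P.sitesPerDir_dvd_succ_mul j
  have h3 := h2.of_dvd hdvd
  push_cast
  rw [mul_comm (P.L : ℤ) (t κ)]
  exact h3

/-- **THE COUNT BOX OF A SHORT WORD READ FROM A BLOCK CENTRE**: if every net displacement of `u` is in `[−(2L−1), 2L−1]`, then the site
`walkEnd (emb y) u` lies in a block within coarse torus distance `2d` of `y` (standing range `j + 1 ≤ m + K`).  (Write the displacement as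
`L·t + e` with `|t_κ| ≤ 2`, `|e_κ| ≤ (L−1)∕2`; then the site is `emb (y + t) + e ∈ B(y + t)` by `blockOf_eq_of_near_emb`.) [folklore] -/
theorem tdist_blockOf_walkEnd_le (hj : j + 1 ≤ P.m + P.K) (y : Site P (j + 1)) (u : List (Letter P.d))
    (hu : ∀ κ, -((2 * P.L - 1 : ℕ) : ℤ) ≤ netDisp u κ ∧ netDisp u κ ≤ ((2 * P.L - 1 : ℕ) : ℤ)) :
    Site.tdist (blockOf (walkEnd (emb y) u)) y ≤ 2 * P.d := by
  have hL1 : 1 < P.L := P.hL.2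
  have hLodd := AveragingRT.two_mul_half_add_one P
  set hh : ℕ := (P.L - 1) / 2 with hhh
  -- Euclidean decomposition of the displacement: `netDisp u κ = L·t κ + e κ`
  let q : Fin P.d → ℕ := fun κ => (netDisp u κ + hh + 2 * P.L).toNat / P.L
  let t : Fin P.d → ℤ := fun κ => (q κ : ℤ) - 2
  let e : Fin P.d → ℤ := fun κ => netDisp u κ - P.L * t κ
  have hbounds : ∀ κ, (-(hh : ℤ) ≤ e κ ∧ e κ ≤ hh) ∧ (t κ).natAbs ≤ 2 := by
    intro κ
    have hκ := hu κ
    have h0 : 0 ≤ netDisp u κ + hh + 2 * P.L := by omega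
    have hs : ((netDisp u κ + hh + 2 * P.L).toNat : ℤ) = netDisp u κ + hh + 2 * P.L := Int.toNat_of_nonneg h0
    have hdm := Nat.div_add_mod ((netDisp u κ + hh + 2 * P.L).toNat) P.L
    have hml := Nat.mod_lt ((netDisp u κ + hh + 2 * P.L).toNat) P.L_pos
    have hq4 : q κ ≤ 4 := by
      show (netDisp u κ + hh + 2 * P.L).toNat / P.L ≤ 4
      rw [Nat.div_le_iff_le_mul_add_pred P.L_pos]
      have : ((netDisp u κ + hh + 2 * P.L).toNat : ℤ) ≤ ((P.L * 4 + (P.L - 1) : ℕ) : ℤ) := by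
        rw [hs]; push_cast; omega
      exact_mod_cast this
    have hdm' : (P.L : ℤ) * (q κ : ℤ) + (((netDisp u κ + hh + 2 * P.L).toNat % P.L : ℕ) : ℤ) = netDisp u κ + hh + 2 * P.L := by
      rw [← hs]; exact_mod_cast hdm
    have hml' : (((netDisp u κ + hh + 2 * P.L).toNat % P.L : ℕ) : ℤ) < P.L := by exact_mod_cast hml
    have hml0 : (0 : ℤ) ≤ (((netDisp u κ + hh + 2 * P.L).toNat % P.L : ℕ) : ℤ) := by positivity
    refine ⟨?_, ?_⟩
    · show -(hh : ℤ) ≤ netDisp u κ - P.L * ((q κ : ℤ) - 2) ∧ netDisp u κ - P.L * ((q κ : ℤ) - 2) ≤ hh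
      have hL' : (2 * (hh : ℤ) + 1) = P.L := by exact_mod_cast hLodd
      constructor <;> nlinarith
    · show ((q κ : ℤ) - 2).natAbs ≤ 2
      have : (q κ : ℤ) ≤ 4 := by exact_mod_cast hq4
      omega
  -- the shifted coarse site `y + t` and the comparison `walkEnd (emb y) u = emb (y + t) + e`
  let T : Site P (j + 1) := fun κ => ((t κ : ℤ) : ZMod (P.sitesPerDir (j + 1)))
  have hT : ∀ κ, T κ = ((t κ : ℤ) : ZMod (P.sitesPerDir (j + 1))) := fun κ => rfl
  have hcoord : ∀ ν, walkEnd (emb y) u ν = emb (y + T) ν + ((e ν : ℤ) : ZMod (P.sitesPerDir j)) := by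
    intro ν
    rw [walkEnd_apply, Site.emb_add, Site.add_apply, scale_intCast_apply T t hT]
    push_cast
    show emb y ν + ((netDisp u ν : ℤ) : ZMod (P.sitesPerDir j)) =
      emb y ν + ((P.L : ZMod (P.sitesPerDir j)) * ((t ν : ℤ) : ZMod (P.sitesPerDir j))) +
        (((netDisp u ν - P.L * t ν : ℤ)) : ZMod (P.sitesPerDir j))
    push_cast; ring
  have hblock : blockOf (walkEnd (emb y) u) = y + T :=
    blockOf_eq_of_near_emb hj (y + T) (walkEnd (emb y) u) e hcoord (fun ν => (hbounds ν).1)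
  rw [hblock]
  refine (tdist_add_intCast_le y T t hT).trans ?_
  calc ∑ κ, (t κ).natAbs ≤ ∑ _κ : Fin P.d, 2 := Finset.sum_le_sum fun κ _ => (hbounds κ).2
    _ = 2 * P.d := by simp [mul_comm]

/-- Every site of the three blocks `B(y − e_ν) ∪ B(y) ∪ B(y + e_ν)` is within coarse torus distance `2d` of `y` (`d ≥ 1`). [folklore] -/
theorem tdist_le_two_mul_d_of_three_blocks (y z : Site P (j + 1)) (ν : Fin P.d)
    (hz : z = y.unshift ν ∨ z = y ∨ z = y.shift ν) : Site.tdist z y ≤ 2 * P.d := by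
  have hd : 1 ≤ P.d := P.hd
  rcases hz with rfl | rfl | rfl
  · exact (B3Taylor310LocalRemainder.tdist_unshift_le_one y ν).trans (by omega)
  · rw [tdist_self]; omega
  · have h := B3Taylor310LocalRemainder.tdist_unshift_le_one (y.shift ν) ν
    rw [B10StarCount.unshift_shift] at h
    rw [tdist_comm]
    exact h.trans (by omega)

end Geometry

/-! ## §2 The centred offsets and the staircase from the block centre -/

section Offsets

variable {P : Params} {j : ℕ}

/-- A staircase with all offsets zero is the empty word. [folklore] -/
theorem stairWord_zero (σ : Equiv.Perm (Fin P.d)) : stairWord σ (fun _ : Fin P.d => (0 : ℤ)) = [] := by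
  rw [stairWord]
  suffices h : ∀ as : List (Fin P.d), stairRuns (fun _ : Fin P.d => (0 : ℤ)) as = [] from h _
  intro as
  induction as with
  | nil => rfl
  | cons a as ih => rw [stairRuns, ih]; simp [axisRun]

/-- The centred offset of a fine site in its block is at most `(L−1)∕2` in absolute value (`L` odd). [cite: Balaban1987RG1, (0.3) p.252] -/
theorem ctrOff_bounds (x : Site P j) (κ : Fin P.d) :
    -(((P.L - 1) / 2 : ℕ) : ℤ) ≤ (((x κ).val % P.L : ℕ) : ℤ) - (((P.L - 1) / 2 : ℕ) : ℤ) ∧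
      (((x κ).val % P.L : ℕ) : ℤ) - (((P.L - 1) / 2 : ℕ) : ℤ) ≤ (((P.L - 1) / 2 : ℕ) : ℤ) := by
  have hL := AveragingRT.two_mul_half_add_one P
  have hm : (x κ).val % P.L < P.L := Nat.mod_lt _ P.L_pos
  constructor <;> omega

/-- The centred offsets of a block centre vanish (standing range). [cite: Balaban1987RG1, (0.1) p.252] -/
theorem ctrOff_emb (hj : j + 1 ≤ P.m + P.K) (y : Site P (j + 1)) :
    (fun κ => (((emb y κ).val % P.L : ℕ) : ℤ) - (((P.L - 1) / 2 : ℕ) : ℤ)) = fun _ : Fin P.d => (0 : ℤ) := by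
  funext κ
  have hL := AveragingRT.two_mul_half_add_one P
  rw [Site.val_emb hj, Nat.mul_add_mod', Nat.mod_eq_of_lt (by omega)]
  simp

/-- **THE STAIRCASE FROM THE BLOCK CENTRE REACHES THE SITE**: `walkEnd (emb (blockOf x)) Γ^σ(n(x)) = x` for the centred offsets `n(x)`
(standing range). [cite: Balaban1987RG1, (0.3) p.252] -/
theorem walkEnd_emb_blockOf_stairWord (hj : j + 1 ≤ P.m + P.K) (x : Site P j) (σ : Equiv.Perm (Fin P.d)) :
    walkEnd (emb (blockOf x)) (stairWord σ (fun κ => (((x κ).val % P.L : ℕ) : ℤ) - (((P.L - 1) / 2 : ℕ) : ℤ))) = x := by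
  funext κ
  rw [BlockAveragingEMLProp2.walkEnd_stairWord_apply]
  have he : emb (blockOf x) κ = ((((x κ).val / P.L) * P.L + (P.L - 1) / 2 : ℕ) : ZMod (P.sitesPerDir j)) := by
    rw [← ZMod.natCast_zmod_val (emb (blockOf x) κ), Site.val_emb hj, Site.val_blockOf hj]
  have hdm : (x κ).val / P.L * P.L + (x κ).val % P.L = (x κ).val := Nat.div_add_mod' _ _
  have hx : x κ = ((((x κ).val / P.L) * P.L + (x κ).val % P.L : ℕ) : ZMod (P.sitesPerDir j)) := by
    rw [hdm, ZMod.natCast_zmod_val]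
  rw [he]
  conv_rhs => rw [hx]
  generalize (x κ).val / P.L = q
  generalize (x κ).val % P.L = r
  generalize (P.L - 1) / 2 = hh
  push_cast
  ring

end Offsets

end Summit.QuantumFields.YangMills.Theorems.PoincareLipschitzHierAlignWords

end
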